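import Summits.Langlands.Langlands.Theorems.IrreducibilityBySelfDualityPairLBoundaryJS
import Summits.Langlands.Langlands.Theorems.IrreducibilityBySelfDualityPairLBoundaryJSSsv
import Summits.Langlands.Langlands.Theorems.IrreducibilityBySelfDualityPairLBoundaryJSStandardEntire
import Summits.Langlands.Langlands.Theorems.IrreducibilityBySelfDualityPairLBoundaryJSIsOrthoOfLocalTranslate
import Summits.Langlands.Langlands.Theorems.IrreducibilityBySelfDualityPairLBoundaryJSEqConjOfLocalTranslate
import Summits.Langlands.Langlands.Theorems.IrreducibilityBySelfDualityPairLBoundaryJSLocalPairTranslate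
import Summits.Langlands.Langlands.Theorems.IrreducibilityBySelfDualityPairLBoundaryJSOfHumphriesJo
import Literature.NumberTheory.Automorphic.PairLFunctionMeromorphicContinuationRankNeTwistProofs
import Literature.NumberTheory.Automorphic.ArchRankinSelbergTestVector
import Literature.NumberTheory.Automorphic.JPSSGlobalIntegralQuotientUnfolding
import Literature.NumberTheory.Automorphic.JPSSCornerWhittakerUnfolding
import Literature.NumberTheory.Automorphic.WhittakerPeriodExchange
import Literature.NumberTheory.Automorphic.TorusIwasawaTransport
import Literature.NumberTheory.Automorphic.CornerTorusIwasawaData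
import Literature.NumberTheory.Automorphic.WhittakerCoeffHonestCuspForm
import Literature.NumberTheory.Automorphic.WhittakerCoeffTranslateUnramified
import Literature.NumberTheory.Automorphic.WhittakerDecayCuspForm
import Literature.NumberTheory.Automorphic.WhittakerSupportFinite
import Literature.NumberTheory.Automorphic.RankinSelbergUnramifiedTorus
import Literature.NumberTheory.Automorphic.RankinSelbergTorusPairEuler
import Literature.NumberTheory.Automorphic.RankinSelbergTowerFiniteness

/-!
# The single-idele integral of the corner majorant: shells and the archimedean moment

Summit `Langlands`, sub-problem `Langlands`, helper file under `Theorems/` supporting the crux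
`PairLBoundaryJS` (stmt-Langlands-13622), line `Sketch`, registered stub `stub_corner_abs_convergence` (W-Ac),
part 2 of 4: the one-coordinate integrals of the torus majorant of the unfolded `GL_{m+1} × GL_m` integral
(Cogdell (2004), §2.3 "absolutely convergent for `Re s ≫ 0`"; Jacquet–Shalika (1981), §4), modelled on
`TorusSecondCoordinateIntegral.setLIntegral_ideleUnitBox_expWeight_lt_top` (exponential weight, exponent `2`)
with a POLYNOMIAL archimedean weight and a REAL exponent:

* `tsum_int_indicator_zpow_rpow_lt_top` — the shifted geometric series `Σ_{n ≥ c} ((q⁻¹)^n)^e < ∞`;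
* `lintegral_mixedUnits_archDecay_rpow_lt_top` — `∫_{K_∞ˣ} (∏_w min(1, ‖x_w‖^{-M})) N(x)^e d^×x < ∞` for
  `1 ≤ e ≤ E`, `M ≥ [K:ℚ]E + dim_ℝ K_∞ + 1` (`d^×x = dx/N(x)`, `N(x) ≤ ‖x‖^{[K:ℚ]}`, the Japanese bracket);
* `setLIntegral_ideleUnitBox_majorant_lt_top` / `stub_corner_idele_moment` —
  `∫_{B(Sᶜ)} 𝟙{|y_v|_v ≤ R_v} (∏_w min(1, ‖y_w‖^{-M})) ‖y‖^e dν(y) < ∞` (shells at `S`, `IdeleUnitBoxShells`;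
  archimedean pushforward `UnitIdeleArchPushforward`).

## References

* J. W. Cogdell, *Analytic theory of L-functions for GL_n* (2004), §2.3 [CogdellAnalyticTheory2004].
* H. Jacquet, J. A. Shalika, Amer. J. Math. 103 (1981), §4 [JacquetShalikaAJM1981].
-/

noncomputable section

-- `Summit.Langlands.Langlands.…` (summit = sub-problem name, D-0017 layout) trips `dupNamespace`
set_option linter.dupNamespace false

open scoped MatrixGroups Topology Pointwise ENNReal NNReal ComplexConjugate InnerProductSpace ContDiff
-- the place subtypes indexing `mixedSpace K` are `Fintype` classically (`NormedCommRing (mixedSpace K)`)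
open scoped Classical Matrix.Norms.Operator
open NumberField IsDedekindDomain MeasureTheory Measure Matrix Set Filter WithZero
open NumberField.mixedEmbedding
open Literature.NumberTheory.Automorphic AdelicGroupData
open Literature.NumberTheory.GaloisRepresentations (ideleGroup HeckeCharacter)
open Literature.MeasureTheory.Group
open Literature.RingTheory.SymmetricFunctions.SymmPoly
open ValuativeRel

-- the automorphic quotient carries the tree's Borel σ-algebra, not Mathlib's quotient σ-algebra
attribute [-instance] Quotient.instMeasurableSpace QuotientGroup.measurableSpace

-- the house local instances, exactly as in `RankinSelbergUnfoldingIdentity`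
attribute [local instance] adelicBorel borelSpace_adelic locallyCompactSpace_adelic secondCountableTopology_gl_adelic
  glAdeleBorel borelSpace_glAdele borelSpace_ideleGroup secondCountableTopology_ideleGroup

-- Mathlib idiom: the commutator Lie ring on matrices, to mention `(archGroupGL n K).lie`
attribute [local instance 100] LieRing.ofAssociativeRing


namespace Summit.Langlands.Langlands.Theorems.CornerAbsIdeleMoment

open Literature.NumberTheory.GaloisRepresentations (unitIdeles localUnits)

/-! ### Shifted geometric series over `ℤ` -/

/-- `Σ_{n ∈ ℤ, n ≥ c} ((q⁻¹)^n)^e < ∞` for `q > 1`, `e > 0`. [folklore] -/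
theorem tsum_int_indicator_zpow_rpow_lt_top {q : ℝ} (hq : 1 < q) {e : ℝ} (he : 0 < e) (c : ℤ) :
    ∑' n : ℤ, (if c ≤ n then ENNReal.ofReal (((q⁻¹) ^ n) ^ e) else 0) < ⊤ := by
  have hq0 : 0 < q := zero_lt_one.trans hq
  have hqi0 : 0 ≤ q⁻¹ := inv_nonneg.2 hq0.le
  set r : ℝ := (q⁻¹) ^ e with hr
  have hr0 : 0 ≤ r := Real.rpow_nonneg hqi0 e
  have hr1 : r < 1 := Real.rpow_lt_one hqi0 (inv_lt_one_of_one_lt₀ hq) he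
  set A : ℝ := ((q⁻¹) ^ c) ^ e with hA
  have hA0 : 0 ≤ A := Real.rpow_nonneg (zpow_nonneg hqi0 c) e
  have hinj : Function.Injective fun j : ℕ => c + (j : ℤ) := fun j j' h => by simpa using h
  have h : ∑' n : ℤ, (if c ≤ n then ENNReal.ofReal (((q⁻¹) ^ n) ^ e) else 0) =
      ∑' j : ℕ, ENNReal.ofReal A * (ENNReal.ofReal r) ^ j := by
    rw [← hinj.tsum_eq (f := fun n : ℤ => if c ≤ n then ENNReal.ofReal (((q⁻¹) ^ n) ^ e) else 0)]
    · refine tsum_congr fun j => ?_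
      rw [if_pos (by omega), zpow_add₀ (inv_ne_zero hq0.ne') c j, zpow_natCast,
        Real.mul_rpow (zpow_nonneg hqi0 c) (pow_nonneg hqi0 j), ← hA, ENNReal.ofReal_mul hA0,
        ← Real.rpow_natCast (q⁻¹) j, ← Real.rpow_mul hqi0, mul_comm (j : ℝ) e, Real.rpow_mul hqi0,
        Real.rpow_natCast, ← hr, ENNReal.ofReal_pow hr0]
    · intro n hn
      rw [Function.mem_support] at hn
      by_cases hcn : c ≤ n
      · refine ⟨(n - c).toNat, ?_⟩
        simp only
        rw [Int.toNat_of_nonneg (sub_nonneg.2 hcn)]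
        ring
      · exact absurd (if_neg hcn) hn
  rw [h, ENNReal.tsum_mul_left, ENNReal.tsum_geometric]
  refine ENNReal.mul_lt_top ENNReal.ofReal_lt_top (ENNReal.inv_lt_top.2 (tsub_pos_iff_lt.2 ?_))
  exact ENNReal.ofReal_lt_one.2 hr1

/-! ### The archimedean moment `∫_{K_∞ˣ} ∏_w min(1, ‖x_w‖^{-M}) N(x)^e d^×x < ∞` -/

section Arch

variable {K : Type} [Field K] [NumberField K]

attribute [local instance] Literature.MeasureTheory.Group.Units.borelSpace_of_isOpenEmbedding
  Literature.MeasureTheory.Group.hasSummableGeomSeries_of_finiteDimensional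

omit [NumberField K] in
/-- `‖eval_w (e y)‖ = ‖y_w‖` for `y ∈ K_∞` and Mathlib's `e = ringEquiv_mixedSpace K` (the components are
the isometries `K_w ≃ ℝ`, `K_w ≃ ℂ`). [folklore] -/
theorem norm_mixedSpaceEvalAt_ringEquiv_mixedSpace (y : InfiniteAdeleRing K) (w : InfinitePlace K) :
    ‖mixedSpaceEvalAt K w (InfiniteAdeleRing.ringEquiv_mixedSpace K y)‖ = ‖y w‖ := by
  have hiso := (InfinitePlace.Completion.isometry_extensionEmbedding w).norm_map_of_map_zero (map_zero _) (y w)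
  rcases InfinitePlace.isReal_or_isComplex w with hw | hw
  · have h1 : InfinitePlace.Completion.extensionEmbedding w (y w) =
        ((InfiniteAdeleRing.ringEquiv_mixedSpace K y).1 ⟨w, hw⟩ : ℂ) := by
      rw [InfiniteAdeleRing.ringEquiv_mixedSpace_apply]
      exact (InfinitePlace.Completion.extensionEmbeddingOfIsReal_apply hw _).symm
    rw [mixedSpaceEvalAt_of_isReal hw, ← h1, hiso]
  · have h2 : InfinitePlace.Completion.extensionEmbedding w (y w) =
        (InfiniteAdeleRing.ringEquiv_mixedSpace K y).2 ⟨w, hw⟩ := rfl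
    rw [mixedSpaceEvalAt_of_isComplex hw, ← h2, hiso]

/-- Some archimedean component dominates the sup norm: `‖x‖ ≤ ‖(e⁻¹ x)_w‖` for some `w`. [folklore] -/
theorem exists_norm_le_norm_ringEquiv_mixedSpace_symm (x : mixedSpace K) :
    ∃ w : InfinitePlace K, ‖x‖ ≤ ‖(InfiniteAdeleRing.ringEquiv_mixedSpace K).symm x w‖ := by
  obtain ⟨w, hw⟩ := exists_norm_le_norm_mixedSpaceEvalAt (K := K) x
  refine ⟨w, ?_⟩
  rw [← norm_mixedSpaceEvalAt_ringEquiv_mixedSpace, RingEquiv.apply_symm_apply]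
  exact hw

/-- **The archimedean moment of the corner majorant**: for `1 ≤ e ≤ E` and
`M ≥ [K:ℚ] E + dim_ℝ K_∞ + 1`,
`∫_{K_∞ˣ} (∏_w min(1, ‖x_w‖^{-M})) N(x)^e d^×x < ∞` (`d^×x = dx / N(x)`, `N(x) ≤ ‖x‖^{[K:ℚ]}`, and the
Japanese bracket `finite_integral_one_add_norm`). [folklore] -/
theorem lintegral_mixedUnits_archDecay_rpow_lt_top {E M : ℕ} {e : ℝ} (he1 : 1 ≤ e) (heE : e ≤ E)
    (hM : Module.finrank ℚ K * E + Module.finrank ℝ (mixedSpace K) + 1 ≤ M) :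
    ∫⁻ x, ENNReal.ofReal ((∏ w : InfinitePlace K,
        ((max 1 ‖(InfiniteAdeleRing.ringEquiv_mixedSpace K).symm ((x : (mixedSpace K)ˣ) : mixedSpace K) w‖) ^ M)⁻¹) *
        mixedEmbedding.norm ((x : (mixedSpace K)ˣ) : mixedSpace K) ^ e) ∂mixedUnitsHaar K < ⊤ := by
  set ε := (InfiniteAdeleRing.ringEquiv_mixedSpace K).symm with hε
  set D : ℕ := Module.finrank ℚ K with hD
  set d : ℕ := Module.finrank ℝ (mixedSpace K) with hd
  set P : mixedSpace K → ℝ := fun x => ∏ w : InfinitePlace K, ((max 1 ‖ε x w‖) ^ M)⁻¹ with hP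
  set g : mixedSpace K → ℝ≥0∞ := fun x => ENNReal.ofReal (P x * mixedEmbedding.norm x ^ e) with hg
  have hεc : Continuous ε := continuous_ringEquiv_mixedSpace_symm K
  have hmax : ∀ (x : mixedSpace K) (w : InfinitePlace K), 0 < (max 1 ‖ε x w‖) ^ M := fun x w =>
    pow_pos (lt_of_lt_of_le one_pos (le_max_left _ _)) M
  have hPc : Continuous P := by
    refine continuous_finsetProd _ fun w _ => ?_
    exact ((continuous_const.max ((continuous_apply w).comp hεc).norm).pow M).inv₀ fun x => (hmax x w).ne'
  have hNc : Continuous (mixedEmbedding.norm : mixedSpace K → ℝ) := by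
    have : Continuous fun x : mixedSpace K => ∏ w : InfinitePlace K, normAtPlace w x ^ w.mult :=
      continuous_finsetProd _ fun w _ => (continuous_normAtPlace w).pow _
    convert this using 1
    funext x
    exact mixedEmbedding.norm_apply x
  have hgm : Measurable g :=
    ENNReal.measurable_ofReal.comp (hPc.mul (hNc.rpow_const fun x => Or.inr (by linarith))).measurable
  have hP0 : ∀ x, 0 ≤ P x := fun x => Finset.prod_nonneg fun w _ => (inv_pos.2 (hmax x w)).le
  have hP1 : ∀ x, P x ≤ ((max 1 ‖x‖) ^ M)⁻¹ := by
    intro x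
    obtain ⟨w₀, hw₀⟩ := exists_norm_le_norm_ringEquiv_mixedSpace_symm (K := K) x
    have hfac : ∀ w, ((max 1 ‖ε x w‖) ^ M)⁻¹ ≤ 1 := fun w =>
      inv_le_one_of_one_le₀ (one_le_pow₀ (le_max_left _ _))
    calc P x = ((max 1 ‖ε x w₀‖) ^ M)⁻¹ * ∏ w ∈ Finset.univ.erase w₀, ((max 1 ‖ε x w‖) ^ M)⁻¹ := by
          rw [hP]; exact (Finset.mul_prod_erase _ _ (Finset.mem_univ w₀)).symm
      _ ≤ ((max 1 ‖ε x w₀‖) ^ M)⁻¹ * 1 :=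
          mul_le_mul_of_nonneg_left (Finset.prod_le_one (fun w _ => (inv_pos.2 (hmax x w)).le) fun w _ => hfac w)
            (inv_pos.2 (hmax x w₀)).le
      _ ≤ ((max 1 ‖x‖) ^ M)⁻¹ := by
          rw [mul_one]
          exact inv_anti₀ (pow_pos (lt_of_lt_of_le one_pos (le_max_left _ _)) M)
            (pow_le_pow_left₀ (le_trans zero_le_one (le_max_left _ _)) (max_le_max le_rfl hw₀) M)
  -- the pointwise bound of the density against Lebesgue measure
  have hbound : ∀ x : mixedSpace K, g x * (ENNReal.ofReal (mixedEmbedding.norm x))⁻¹ ≤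
      ENNReal.ofReal ((2 : ℝ) ^ (d + 1) * (1 + ‖x‖) ^ (-((d : ℝ) + 1))) := by
    intro x
    by_cases hN : mixedEmbedding.norm x = 0
    · rw [hg]
      simp only
      rw [hN, Real.zero_rpow (by linarith), mul_zero, ENNReal.ofReal_zero, zero_mul]
      exact zero_le
    have hNpos : 0 < mixedEmbedding.norm x := lt_of_le_of_ne (mixedEmbedding.norm_nonneg x) (Ne.symm hN)
    set u : ℝ := max 1 ‖x‖ with hu
    have hu1 : 1 ≤ u := le_max_left _ _
    have hu0 : 0 < u := lt_of_lt_of_le one_pos hu1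
    have e1 : g x * (ENNReal.ofReal (mixedEmbedding.norm x))⁻¹ =
        ENNReal.ofReal (P x * mixedEmbedding.norm x ^ (e - 1)) := by
      rw [hg]
      simp only
      rw [Real.rpow_sub_one hN, ← mul_div_assoc, ENNReal.ofReal_div_of_pos hNpos, div_eq_mul_inv]
    rw [e1]
    refine ENNReal.ofReal_le_ofReal ?_
    -- `N^(e-1) ≤ u^(D E)`
    have hN1 : mixedEmbedding.norm x ^ (e - 1) ≤ u ^ (D * E) := by
      have h1 : mixedEmbedding.norm x ≤ u ^ D :=
        (mixedEmbedding_norm_le_norm_pow K x).trans (pow_le_pow_left₀ (norm_nonneg _) (le_max_right _ _) D)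
      calc mixedEmbedding.norm x ^ (e - 1) ≤ (u ^ D) ^ (e - 1) :=
            Real.rpow_le_rpow (mixedEmbedding.norm_nonneg x) h1 (by linarith)
        _ ≤ (u ^ D) ^ ((E : ℕ) : ℝ) :=
            Real.rpow_le_rpow_of_exponent_le (one_le_pow₀ hu1) (by linarith)
        _ = u ^ (D * E) := by rw [Real.rpow_natCast, ← pow_mul]
    -- `P x N^(e-1) ≤ u^{-M} u^{DE} ≤ u^{-(d+1)} ≤ 2^{d+1} (1 + ‖x‖)^{-(d+1)}`
    have h2 : P x * mixedEmbedding.norm x ^ (e - 1) ≤ (u ^ M)⁻¹ * u ^ (D * E) :=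
      mul_le_mul (hP1 x) hN1 (Real.rpow_nonneg (mixedEmbedding.norm_nonneg x) _) (inv_pos.2 (pow_pos hu0 M)).le
    have h3 : (u ^ M)⁻¹ * u ^ (D * E) ≤ (u ^ (d + 1))⁻¹ := by
      rw [inv_mul_eq_div, ← one_div, div_le_div_iff₀ (pow_pos hu0 M) (pow_pos hu0 (d + 1)), one_mul,
        ← pow_add]
      exact pow_le_pow_right₀ hu1 (by rw [← add_assoc]; exact hM)
    have h4 : (u ^ (d + 1))⁻¹ ≤ (2 : ℝ) ^ (d + 1) * (1 + ‖x‖) ^ (-((d : ℝ) + 1)) := by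
      have hx1 : 0 < 1 + ‖x‖ := by positivity
      have e2 : (1 + ‖x‖) ^ (-((d : ℝ) + 1)) = ((1 + ‖x‖) ^ (d + 1))⁻¹ := by
        rw [Real.rpow_neg hx1.le, show ((d : ℝ) + 1) = ((d + 1 : ℕ) : ℝ) by push_cast; ring, Real.rpow_natCast]
      have h5 : (1 + ‖x‖) ^ (d + 1) ≤ (2 * u) ^ (d + 1) :=
        pow_le_pow_left₀ hx1.le (by linarith [le_max_left 1 ‖x‖, le_max_right 1 ‖x‖]) _
      rw [e2, ← div_eq_mul_inv, le_div_iff₀ (pow_pos hx1 _), inv_mul_le_iff₀ (pow_pos hu0 _), ← mul_pow,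
        mul_comm u]
      exact h5
    exact h2.trans (h3.trans h4)
  -- integrate
  have hlhs : ∫⁻ x, ENNReal.ofReal ((∏ w : InfinitePlace K, ((max 1 ‖ε ((x : (mixedSpace K)ˣ) : mixedSpace K) w‖) ^ M)⁻¹) *
      mixedEmbedding.norm ((x : (mixedSpace K)ˣ) : mixedSpace K) ^ e) ∂mixedUnitsHaar K =
      ∫⁻ x, g ((x : (mixedSpace K)ˣ) : mixedSpace K) ∂mixedUnitsHaar K := rfl
  rw [hlhs, lintegral_mixedUnitsHaar K hgm]
  calc ∫⁻ x in {x : mixedSpace K | IsUnit x}, g x * (ENNReal.ofReal (mixedEmbedding.norm x))⁻¹ ∂volume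
      ≤ ∫⁻ x, g x * (ENNReal.ofReal (mixedEmbedding.norm x))⁻¹ ∂volume := setLIntegral_le_lintegral _ _
    _ ≤ ∫⁻ x, ENNReal.ofReal ((2 : ℝ) ^ (d + 1) * (1 + ‖x‖) ^ (-((d : ℝ) + 1))) ∂volume := lintegral_mono hbound
    _ = ENNReal.ofReal ((2 : ℝ) ^ (d + 1)) * ∫⁻ x : mixedSpace K, ENNReal.ofReal ((1 + ‖x‖) ^ (-((d : ℝ) + 1))) ∂volume := by
        rw [← lintegral_const_mul' _ _ ENNReal.ofReal_ne_top]
        refine lintegral_congr fun x => ?_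
        rw [ENNReal.ofReal_mul (by positivity)]
    _ < ⊤ := ENNReal.mul_lt_top ENNReal.ofReal_lt_top (finite_integral_one_add_norm (by rw [hd]; linarith))

end Arch

/-! ### The single-idele integral over `B(Sᶜ)`: shells at `S` -/

section Idele

variable {K : Type} [Field K] [NumberField K]
variable [MeasurableSpace (AdeleRing (𝓞 K) K)] [BorelSpace (AdeleRing (𝓞 K) K)]

attribute [local instance] Literature.MeasureTheory.Group.Units.borelSpace_of_isOpenEmbedding
  Literature.MeasureTheory.Group.hasSummableGeomSeries_of_finiteDimensional

/-- **The single-idele majorant integrates over `B(Sᶜ)`.** For a left-invariant measure `ν` on `𝕀_K`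
finite on compacts, a finite set `S` of finite places, bounds `R_v ≥ 1`, `1 ≤ e ≤ E` and
`M ≥ [K:ℚ] E + dim_ℝ K_∞ + 1`:
`∫_{B(Sᶜ)} 𝟙{|y_v|_v ≤ R_v ∀ v} (∏_w min(1, ‖y_w‖^{-M})) ‖y‖^e dν(y) < ∞` (shells at `S`,
`IdeleUnitBoxShells`; the shell sums are the shifted geometric series `Σ_{n ≥ -log R_v} q_v^{-n e}`; the
archimedean pushforward `UnitIdeleArchPushforward` and `lintegral_mixedUnits_archDecay_rpow_lt_top`).
[folklore] -/
theorem setLIntegral_ideleUnitBox_majorant_lt_top (ν : Measure (ideleGroup K)) [IsFiniteMeasureOnCompacts ν]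
    [ν.IsMulLeftInvariant] (S : Finset (HeightOneSpectrum (𝓞 K)))
    {R : HeightOneSpectrum (𝓞 K) → WithZero (Multiplicative ℤ)} (hR : ∀ v, 1 ≤ R v)
    {E M : ℕ} {e : ℝ} (he1 : 1 ≤ e) (heE : e ≤ E)
    (hM : Module.finrank ℚ K * E + Module.finrank ℝ (mixedSpace K) + 1 ≤ M) :
    ∫⁻ y in ideleUnitBox (K := K) {w | w ∉ S},
      (if ∀ v, Valued.v (((y : ideleGroup K) : AdeleRing (𝓞 K) K).2 v) ≤ R v then 1 else 0) *
        ENNReal.ofReal (∏ w : InfinitePlace K, ((max 1 ‖((y : ideleGroup K) : AdeleRing (𝓞 K) K).1 w‖) ^ M)⁻¹) *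
        ENNReal.ofReal ((IdeleClassGroup.ideleNorm K y : ℝ) ^ e) ∂ν < ⊤ := by
  obtain ⟨ϖ, hϖ⟩ := exists_uniformizers (K := K)
  haveI : BorelSpace (mixedSpace K)ˣ := Literature.MeasureTheory.Group.Units.borelSpace_of_isOpenEmbedding
  set ε := (InfiniteAdeleRing.ringEquiv_mixedSpace K).symm with hε
  -- the archimedean factor
  set P : (mixedSpace K)ˣ → ℝ := fun x => ∏ w : InfinitePlace K, ((max 1 ‖ε (x : mixedSpace K) w‖) ^ M)⁻¹ with hP
  set H : (mixedSpace K)ˣ → ℝ≥0∞ := fun x =>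
    ENNReal.ofReal (P x * mixedEmbedding.norm (x : mixedSpace K) ^ e) with hH
  have hmax : ∀ (x : (mixedSpace K)ˣ) (w : InfinitePlace K), 0 < (max 1 ‖ε (x : mixedSpace K) w‖) ^ M := fun x w =>
    pow_pos (lt_of_lt_of_le one_pos (le_max_left _ _)) M
  have hP0 : ∀ x, 0 ≤ P x := fun x => Finset.prod_nonneg fun w _ => (inv_pos.2 (hmax x w)).le
  have hεc : Continuous ε := continuous_ringEquiv_mixedSpace_symm K
  have hPc : Continuous P := by
    refine continuous_finsetProd _ fun w _ => ?_
    exact ((continuous_const.max ((continuous_apply w).comp (hεc.comp Units.continuous_val)).norm).pow M).inv₀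
      fun x => (hmax x w).ne'
  have hNc : Continuous fun x : (mixedSpace K)ˣ => mixedEmbedding.norm (x : mixedSpace K) := by
    have : Continuous fun x : mixedSpace K => ∏ w : InfinitePlace K, normAtPlace w x ^ w.mult :=
      continuous_finsetProd _ fun w _ => (continuous_normAtPlace w).pow _
    have e1 : (mixedEmbedding.norm : mixedSpace K → ℝ) = fun x => ∏ w : InfinitePlace K, normAtPlace w x ^ w.mult :=
      funext fun x => mixedEmbedding.norm_apply x
    exact (e1 ▸ this).comp Units.continuous_val
  have hHm : Measurable H :=
    ENNReal.measurable_ofReal.comp (hPc.mul (hNc.rpow_const fun x => Or.inr (by linarith))).measurable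
  have hJ : ∫⁻ x, H x ∂mixedUnitsHaar K < ⊤ := lintegral_mixedUnits_archDecay_rpow_lt_top he1 heE hM
  obtain ⟨c₂, hc₂⟩ := exists_setLIntegral_unitIdeles_eq_mul_lintegral_mixedUnits (K := K) ν
  -- the local factors at `S`
  set g : HeightOneSpectrum (𝓞 K) → ℤ → ℝ≥0∞ := fun v n =>
    if -WithZero.log (R v) ≤ n then ENNReal.ofReal ((((v.residueCard : ℝ)⁻¹) ^ n) ^ e) else 0 with hg
  have hR0 : ∀ v, R v ≠ 0 := fun v => ne_of_gt (lt_of_lt_of_le zero_lt_one (hR v))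
  -- shells
  rw [setLIntegral_ideleUnitBox_eq_tsum ϖ ν hϖ S]
  have hterm : ∀ n : ↥S → ℤ,
      ∫⁻ b in (unitIdeles K : Set (ideleGroup K)),
        (if ∀ v, Valued.v ((((shellIdele ϖ S n * b : ideleGroup K)) : AdeleRing (𝓞 K) K).2 v) ≤ R v then 1 else 0) *
          ENNReal.ofReal (∏ w : InfinitePlace K,
            ((max 1 ‖(((shellIdele ϖ S n * b : ideleGroup K)) : AdeleRing (𝓞 K) K).1 w‖) ^ M)⁻¹) *
          ENNReal.ofReal ((IdeleClassGroup.ideleNorm K (shellIdele ϖ S n * b) : ℝ) ^ e) ∂ν =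
        (∏ v ∈ S.attach, g v.1 (n v)) * (c₂ * ∫⁻ x, H x ∂mixedUnitsHaar K) := by
    intro n
    have hgtop : (∏ v ∈ S.attach, g v.1 (n v)) ≠ ⊤ :=
      ENNReal.prod_ne_top fun v _ => by simp only [hg]; split_ifs <;> simp
    rw [← hc₂ H hHm, ← lintegral_const_mul' _ _ hgtop]
    refine setLIntegral_congr_fun (Literature.NumberTheory.GaloisRepresentations.isOpen_unitIdeles K).measurableSet fun b hb => ?_
    have hb' : b ∈ unitIdeles K := hb
    -- the indicator
    have hind : (∀ v, Valued.v ((((shellIdele ϖ S n * b : ideleGroup K)) : AdeleRing (𝓞 K) K).2 v) ≤ R v) ↔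
        ∀ v : ↥S, -WithZero.log (R v.1) ≤ n v := by
      constructor
      · intro h v
        have hv := h v.1
        rw [valued_shellIdele_mul_snd ϖ hϖ n hb' v, ← WithZero.le_log_iff_exp_le (hR0 v.1)] at hv
        omega
      · intro h v
        by_cases hv : v ∈ S
        · rw [valued_shellIdele_mul_snd ϖ hϖ n hb' ⟨v, hv⟩, ← WithZero.le_log_iff_exp_le (hR0 v)]
          have := h ⟨v, hv⟩
          dsimp only at this
          omega
        · rw [shellIdele_mul_mem_ideleUnitBox ϖ n hb' v hv]
          exact hR v
    -- the archimedean factor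
    have harch : (∏ w : InfinitePlace K,
        ((max 1 ‖(((shellIdele ϖ S n * b : ideleGroup K)) : AdeleRing (𝓞 K) K).1 w‖) ^ M)⁻¹) = P (archUnitsOfIdele K b) := by
      rw [hP]
      refine Finset.prod_congr rfl fun w _ => ?_
      rw [norm_fst_eq_of_archUnitsOfIdele, archUnitsOfIdele_shellIdele_mul]
    -- the norm
    have hq0 : ∀ v : HeightOneSpectrum (𝓞 K), 0 ≤ ((v.residueCard : ℝ)⁻¹) := fun v => inv_nonneg.2 (Nat.cast_nonneg _)
    have hnorm : ((IdeleClassGroup.ideleNorm K (shellIdele ϖ S n * b) : ℝ)) ^ e =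
        (∏ v ∈ S.attach, (((v.1.residueCard : ℝ)⁻¹) ^ (n v)) ^ e) *
          mixedEmbedding.norm ((archUnitsOfIdele K b : (mixedSpace K)ˣ) : mixedSpace K) ^ e := by
      rw [map_mul, NNReal.coe_mul, ideleNorm_shellIdele ϖ hϖ, ideleNorm_of_mem_unitIdeles hb',
        Real.mul_rpow (Finset.prod_nonneg fun v _ => zpow_nonneg (hq0 v.1) _) (mixedEmbedding.norm_nonneg _),
        Real.finsetProd_rpow _ _ (fun v _ => zpow_nonneg (hq0 v.1) _)]
    by_cases hall : ∀ v : ↥S, -WithZero.log (R v.1) ≤ n v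
    · have hgprod : (∏ v ∈ S.attach, g v.1 (n v)) =
          ENNReal.ofReal (∏ v ∈ S.attach, (((v.1.residueCard : ℝ)⁻¹) ^ (n v)) ^ e) := by
        rw [ENNReal.ofReal_prod_of_nonneg fun v _ => Real.rpow_nonneg (zpow_nonneg (hq0 v.1) _) _]
        refine Finset.prod_congr rfl fun v _ => ?_
        rw [hg]
        simp only
        rw [if_pos (hall v)]
      rw [if_pos (hind.2 hall), one_mul, harch, hnorm, hgprod, hH]
      simp only
      rw [ENNReal.ofReal_mul (hP0 _),
        ENNReal.ofReal_mul (Finset.prod_nonneg fun v _ => Real.rpow_nonneg (zpow_nonneg (hq0 v.1) _) _)]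
      ring
    · obtain ⟨v, hv⟩ := not_forall.1 hall
      rw [if_neg (fun h => hall (hind.1 h)), zero_mul, zero_mul,
        Finset.prod_eq_zero (Finset.mem_attach _ v) (by rw [hg]; simp only; rw [if_neg hv]), zero_mul]
  simp_rw [hterm]
  rw [ENNReal.tsum_mul_right, tsum_prod_shell_eq_prod_tsum g S]
  refine ENNReal.mul_lt_top (ENNReal.prod_lt_top fun v _ => ?_) (ENNReal.mul_lt_top ENNReal.coe_lt_top hJ)
  exact tsum_int_indicator_zpow_rpow_lt_top (by exact_mod_cast v.one_lt_residueCard) (by linarith) _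

end Idele


/-! ### The registered sub-goal -/

/-- **SUB-GOAL (W-Ac, part 2/4) — the single-idele majorant integrates over `B(Sᶜ)`**, the `∀`-form of
`setLIntegral_ideleUnitBox_majorant_lt_top` (registered on stmt-Langlands-13622 so that this helper file lands
`--supports`; consumed by part 3, `…PairLBoundaryJSCornerAbsTorusMajorant`). [folklore] -/
theorem stub_corner_idele_moment :
    ∀ {K : Type} [Field K] [NumberField K] [MeasurableSpace (AdeleRing (𝓞 K) K)] [BorelSpace (AdeleRing (𝓞 K) K)]
      (ν : Measure (ideleGroup K)) [IsFiniteMeasureOnCompacts ν] [ν.IsMulLeftInvariant]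
      (S : Finset (HeightOneSpectrum (𝓞 K))) {R : HeightOneSpectrum (𝓞 K) → WithZero (Multiplicative ℤ)},
      (∀ v, 1 ≤ R v) → ∀ {E M : ℕ} {e : ℝ}, 1 ≤ e → e ≤ E →
      Module.finrank ℚ K * E + Module.finrank ℝ (mixedSpace K) + 1 ≤ M →
      ∫⁻ y in ideleUnitBox (K := K) {w | w ∉ S},
        (if ∀ v, Valued.v (((y : ideleGroup K) : AdeleRing (𝓞 K) K).2 v) ≤ R v then 1 else 0) *
          ENNReal.ofReal (∏ w : InfinitePlace K, ((max 1 ‖((y : ideleGroup K) : AdeleRing (𝓞 K) K).1 w‖) ^ M)⁻¹) *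
          ENNReal.ofReal ((IdeleClassGroup.ideleNorm K y : ℝ) ^ e) ∂ν < ⊤ := by
  intro K _ _ _ _ ν _ _ S R hR E M e he1 heE hM
  exact setLIntegral_ideleUnitBox_majorant_lt_top ν S hR he1 heE hM

end Summit.Langlands.Langlands.Theorems.CornerAbsIdeleMoment

end
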